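import Summits.BirchSwinnertonDyer.BirchSwinnertonDyer.Theorems.SignedLowerHalvesSprungLowerDivisibilityAtThreeKatoSporadicLedgerIota
import Summits.BirchSwinnertonDyer.BirchSwinnertonDyer.Theorems.SignedLowerHalvesSprungLowerDivisibilityAtThreeCokerBoundSkeleton
import Mathlib.Algebra.Module.Torsion.Basic
import HarnessLib

/-!
# Stub-ideation k = 1 (gen 3) for `stub_katoFineLowerSporadic` — card «THE DUALITY LEDGER»
# crux `SprungLowerDivisibilityAtThree` (stmt-BirchSwinnertonDyer-19875; child stmt-…-22569 `KatoFineLowerSporadicX8`)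

HONEST FRAMING. Nothing here proves K_spor, the crux, leaf X8 or BSD; BSD is NOT proved. §A is kernel-checked
bookkeeping over `ℕ` (the lengths at a sporadic height-one prime of the TORSION modules involved are finite); §B are
the helper-lemma SIGNATURES of the card (sorried targets, pure module algebra with the arithmetic inputs DISPLAYED as
hypotheses, in the currency of `ChromaticCommonZeros.min_lengthAt_quotient_range_le_lengthAt_torsion_of_skeleton`,
p652444). Notation at a sporadic height-one `𝔭 ∌ p` of `Λ = ℤ_p⟦T⟧`, `ι𝔭 = PrimeSpectrum.comap (invol p) 𝔭`, NATURAL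
(print) keying, a prime ′ = the same quantity at `ι𝔭`:
* `k = ℓ_𝔭(𝐇¹/Z)` (Kato index), `j = min(ℓ_𝔭 Λ/range Col♯∘loc, ℓ_𝔭 Λ/range Col♭∘loc)` (local index),
  `m = ℓ_𝔭 Λ/(L♯, L♭)` (common-zero multiplicity), `x = ℓ_𝔭 X₀` (fine Selmer dual, natural keying),
  `t = ℓ_𝔭 tors X_rel`, `δ = ℓ_𝔭 X_rel/(tors X_rel + im H¹_Iw(ℚ_p,T))` (transversality defect, card k1-g2).
* LANDED: zeta ledger `k + j = m = k′ + j′` (`ClassX8.zeta_add_localIndex_eq_comap_invol`, p650141).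
* CARD k1-g2 (★): `x + j = t + δ`; Wingberg/Matar: `t = x′`.
* THIS CARD: `δ = j′` (torsion-FREE part of Λ-adic Poitou–Tate duality) ⟹ DUALITY LEDGER `x + j = x′ + j′`.
-/

set_option linter.dupNamespace false
set_option autoImplicit false

noncomputable section

open scoped Classical NumberField MatrixGroups ModularForm

open NumberField IsDedekindDomain CongruenceSubgroup WeierstrassCurve Field
  Literature.NumberTheory.EllipticCurves Literature.NumberTheory.EllipticCurves.ModularForms
  Literature.NumberTheory.EllipticCurves.ZpExtension Literature.NumberTheory.EllipticCurves.Sprung2017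
  Literature.NumberTheory.EllipticCurves.Sprung2012 Literature.NumberTheory.EllipticCurves.Rank1Residual
  Literature.NumberTheory.EllipticCurves.IwasawaAlgebra Literature.NumberTheory.EllipticCurves.Kato2004
  Literature.NumberTheory.EllipticCurves.Module
  Summit.BirchSwinnertonDyer.BirchSwinnertonDyer.Theorems
  Summit.BirchSwinnertonDyer.BirchSwinnertonDyer.Theorems.ChromaticCommonZeros

namespace Summit.BirchSwinnertonDyer.BirchSwinnertonDyer.Cruxes.SprungLowerDivisibilityAtThree.StubKatoFineLowerSporadicK1G3

/-! ## §A  Orbit bookkeeping over `ℕ` (kernel-checked). Variables: `k j x` at `𝔭`, `k' j' x'` at `ι𝔭`;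
`hζ : k + j = k' + j'` = zeta ledger (landed), `hD : x + j = x' + j'` = duality ledger (this card, §B). -/

section Orbit

variable {k j x k' j' x' : ℕ}

/-- **Defect symmetry** `(k − x)(𝔭) = (k − x)(ι𝔭)`, in `ℕ`-form — from the two ledgers alone (no Nakamura FE). -/
theorem defect_symm (hζ : k + j = k' + j') (hD : x + j = x' + j') : k + x' = k' + x := by omega

/-- **Orbit rigidity of print Kato-⊇** (`char X₀ ⊇ (ϖL♯, ϖL♭)` at `𝔭`, i.e. `k ≤ x`): it holds at `𝔭` iff at `ι𝔭`. -/
theorem printKato_orbitRigid (hζ : k + j = k' + j') (hD : x + j = x' + j') : k ≤ x ↔ k' ≤ x' := by omega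

/-- Orbit rigidity of the main-conjecture EQUALITY at sporadic primes. -/
theorem katoEq_orbitRigid (hζ : k + j = k' + j') (hD : x + j = x' + j') : k = x ↔ k' = x' := by omega

/-- Orbit rigidity of Kato 13.4 (`x ≤ k`). -/
theorem thm134_orbitRigid (hζ : k + j = k' + j') (hD : x + j = x' + j') : x ≤ k ↔ x' ≤ k' := by omega

/-- **Orbit rigidity of the cokernel bound F-α** (`j(𝔭) ≤ ℓ_𝔭 tors X_rel = x′`): from the duality ledger ALONE,
F-α at `𝔭` iff F-α at `ι𝔭` — ONE constraint per orbit, not two. -/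
theorem fAlpha_orbitRigid (hD : x + j = x' + j') : j ≤ x' ↔ j' ≤ x := by omega

/-- **The three symmetries coincide**: index symmetry ⟺ local-index symmetry (landed) ⟺ FINE-SELMER symmetry. -/
theorem threeSymmetries (hζ : k + j = k' + j') (hD : x + j = x' + j') :
    (k = k' ↔ j = j') ∧ (j = j' ↔ x = x') := by omega

/-- **Typed line, branch A** (`ℓ_𝔭 Y.X = x′`, the tree's `γ`-keying; typed stub at `𝔭` is `k ≤ x′`, at `ι𝔭` is
`k′ ≤ x`): the typed stub at the member with the SMALLER local index implies it at the other member (card k1-g2 B3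
made unconditional: its side condition `δ(𝔭) + j′ ≤ 2j` is `j′ ≤ j` once `δ = j′`). -/
theorem typedA_of_smallerIndex (hζ : k + j = k' + j') (hD : x + j = x' + j') (hj : j' ≤ j) (h : k' ≤ x) :
    k ≤ x' := by omega

/-- Branch A, orbit form: if `ι𝔭` is the smaller-index member, the typed stub on the whole orbit ⟺ at `ι𝔭` alone. -/
theorem typedA_orbit_iff (hζ : k + j = k' + j') (hD : x + j = x' + j') (hj : j' ≤ j) :
    (k ≤ x' ∧ k' ≤ x) ↔ k' ≤ x := by omega

/-- Branch A, door + residue: typed F-α at `ι𝔭` (`j′ ≤ ℓ_{ι𝔭} Y.X = x`) and the F-α branch `k′ ≤ j′` at the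
smaller-index member close the WHOLE orbit; the residue is «`m > 2·min(j, j′)`», to be proved at ONE member. -/
theorem typedA_orbit_of_door (hζ : k + j = k' + j') (hD : x + j = x' + j') (hj : j' ≤ j) (hFα' : j' ≤ x)
    (hdoor : k' ≤ j') : k ≤ x' ∧ k' ≤ x := by omega

/-- **Branch A verdict, given Kato 13.4 at ONE member** (`x ≤ k`; natural keying): the typed stub on the orbit ⟺
local-index SYMMETRY on the orbit ∧ print Kato-⊇ at one member. So J-SYM is NECESSARY for child 22569 as typed
(card k1-g2 B2, made unconditional in `δ`), and sufficient together with the main-conjecture ⊇ at ONE member. -/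
theorem typedA_orbit_iff_sym_and_print (hζ : k + j = k' + j') (hD : x + j = x' + j') (h134 : x ≤ k) :
    (k ≤ x' ∧ k' ≤ x) ↔ (j = j' ∧ k ≤ x) := by omega

/-- Branch A: at a member whose local index is STRICTLY smaller than its partner's, the typed stub contradicts Kato 13.4
at that member (k1-g2 B2 with `δ = j′`). -/
theorem typedA_absurd_at_strictlySmallerIndex (hD : x + j = x' + j') (hj : j' < j)
    (h134' : x' ≤ k') (h : k' ≤ x) : False := by omega

/-- **Branch B** (`ℓ_𝔭 Y.X = x`, print keying): the tight orbit door `k + k′ ≤ m` (cards k2 N / k5-g3 D_loose)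
with F-α at ONE member closes the print statement at BOTH members. -/
theorem printB_orbit_of_doorTight (hζ : k + j = k' + j') (hD : x + j = x' + j') (hFα : j ≤ x')
    (hdoor : k' ≤ j) : k ≤ x ∧ k' ≤ x' := by omega

/-- **No new length-currency door**: the witness `(k,j,k′,j′,x,x′) = (2,0,2,0,1,1)` satisfies both ledgers,
F-α and 13.4 at both members, all three symmetries — and violates print Kato-⊇ AND the typed stub at both members.
So the residue «main-conjecture ⊇ at one member per orbit» is irreducible in this currency (confirms k1-g2 C, k5-g3 #16). -/
theorem independenceWitness : ∃ k j k' j' x x' : ℕ, k + j = k' + j' ∧ x + j = x' + j' ∧ j ≤ x' ∧ j' ≤ x ∧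
    x ≤ k ∧ x' ≤ k' ∧ k = k' ∧ ¬ k ≤ x ∧ ¬ k ≤ x' ∧ ¬ k' ≤ x := by
  exact ⟨2, 0, 2, 0, 1, 1, by omega⟩

/-- **Branch A cannot be unconditional**: the main-conjecture-EXACT asymmetric orbit `(k,j,k′,j′,x,x′) =
(1,1,2,0,1,2)` satisfies both ledgers and `k = x`, `k′ = x′`, yet the typed stub FAILS at `ι𝔭` (`k′ ≤ x` is `2 ≤ 1`)
— card k1-g2 B2, now consistent with (indeed forced by) the duality ledger. -/
theorem typedA_fails_on_asymmetric_exact_orbit : ∃ k j k' j' x x' : ℕ, k + j = k' + j' ∧ x + j = x' + j' ∧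
    k = x ∧ k' = x' ∧ k ≤ x' ∧ ¬ k' ≤ x := by
  exact ⟨1, 1, 2, 0, 1, 2, by omega⟩

end Orbit

/-! ## §B  Helper-lemma signatures (sorried TARGETS; pure module algebra, arithmetic displayed) -/

section Snake

variable {R : Type*} [CommRing R] {X : Type*} [AddCommGroup X] [Module R X]

/-- **H1 (card k1-g2 (★), restated): the snake identity** for a submodule `N ≤ X` (`N = im H¹_Iw(ℚ_p,T)` in
`X = X_rel`): `ℓ_𝔭(X/N) + ℓ_𝔭(N ⊓ tors X) = ℓ_𝔭(tors X) + ℓ_𝔭(X/(tors X ⊔ N))`, i.e. `x + j = t + δ`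
(second + third isomorphism theorems and additivity `Module.lengthAt_eq_add_of_exact`; any commutative ring). -/
theorem snake_lengthAt -- proved sorry-free in card k1-g2's Sketch (`transversalityLedger_of_injective`); restated
    (N : Submodule R X) (𝔭 : PrimeSpectrum R) :
    Module.lengthAt R (X ⧸ N) 𝔭 + Module.lengthAt R ↥(N ⊓ Submodule.torsion R X) 𝔭 =
      Module.lengthAt R ↥(Submodule.torsion R X) 𝔭 +
        Module.lengthAt R (X ⧸ (Submodule.torsion R X ⊔ N)) 𝔭 := by
  sorry

end Snake

section TorsionFreePosition

variable {p : ℕ} [Fact p.Prime] {X : Type*} [AddCommGroup X] [Module (IwasawaAlgebra p) X]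

/-- **H2 (NEW): transport of the torsion-free position along an `ι`-semilinear duality datum.**
`Ψ : X →+ Λ` additive with `Ψ(r•x) = ι(r)·Ψ(x)` (the composite `X_rel ↠ X_rel,tf ≅ Hom_Λ(𝐇¹,Λ)^ι ≅ Λ^ι`, evaluation at
the generator `h₀` of Kato's cyclic `𝐇¹`), kernel = `tors X` (tf-part of Λ-adic Poitou–Tate / Nekovář duality: `X_tf^ι`
embeds in `Hom_Λ(H¹_Iw(T*(1)),Λ)`), cokernel of `𝔭`-length `0` at `ι𝔭` (the `d₂` lands in `Ext²_Λ(𝐇², Λ)`, pseudo-null).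
THEN `δ(𝔭) = ℓ_𝔭 X/(tors X ⊔ N) = ℓ_{ι𝔭} Λ/⟨Ψ(N)⟩`. Pure algebra: `X/(tors X ⊔ N) ≃+ ⟨range Ψ⟩/⟨Ψ N⟩` `ι`-semilinearly,
then `Kato2004.lengthAt_eq_of_involSemilinear` and additivity. -/
theorem lengthAt_quotient_torsion_sup_eq_comap_invol (N : Submodule (IwasawaAlgebra p) X)
    (Ψ : X →+ IwasawaAlgebra p) (hΨ : ∀ (r : IwasawaAlgebra p) (x : X), Ψ (r • x) = invol p r * Ψ x)
    (hker : ∀ x : X, Ψ x = 0 ↔ x ∈ Submodule.torsion (IwasawaAlgebra p) X)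
    (𝔭 : PrimeSpectrum (IwasawaAlgebra p))
    (hcok : Module.lengthAt (IwasawaAlgebra p) (IwasawaAlgebra p ⧸ Ideal.span (Set.range Ψ))
      (PrimeSpectrum.comap (invol p).toRingHom 𝔭) = 0) :
    Module.lengthAt (IwasawaAlgebra p) (X ⧸ (Submodule.torsion (IwasawaAlgebra p) X ⊔ N)) 𝔭 =
      Module.lengthAt (IwasawaAlgebra p) (IwasawaAlgebra p ⧸ Ideal.span (Ψ '' (N : Set X)))
        (PrimeSpectrum.comap (invol p).toRingHom 𝔭) := by
  sorry

end TorsionFreePosition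

section DualityLedger

variable {p : ℕ} [Fact p.Prime]
  {H P X Y : Type*} [AddCommGroup H] [Module (IwasawaAlgebra p) H] [AddCommGroup P] [Module (IwasawaAlgebra p) P]
  [AddCommGroup X] [Module (IwasawaAlgebra p) X] [AddCommGroup Y] [Module (IwasawaAlgebra p) Y]

/-- **H3 (the card's target): THE DUALITY LEDGER from the cokernel skeleton + the two halves of Poitou–Tate duality.**
Skeleton data exactly as in `min_lengthAt_quotient_range_le_lengthAt_torsion_of_skeleton` (p652444): `loc : 𝐇¹ → P =
H¹_Iw(ℚ_p,T)`, `toX : P → X = X_rel` exact, joint Coleman map `J` injective with `𝔭`- and `ι𝔭`-length-`0` cokernel, colour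
maps `cs, cf`, `𝐇¹ = Λ·h₀`. Displayed arithmetic: (WM) Wingberg 1989 Cor. 2.5 / Matar 2020 Thm. 1.1 as an EQUALITY in the
tree's `γ`-keying, `ℓ_𝔮 tors X = ℓ_𝔮 Y` (`𝔮 = 𝔭, ι𝔭`); (KEY) the same keying for the fine quotient, `ℓ_{ι𝔭} Y = ℓ_𝔭 X/range toX`
(`X/range toX = X₀`, Poitou–Tate); (TF) the duality datum `Ψ` of H2; (LEG) its local leg is the Λ-adic local Tate pairing
against `loc h₀` read through `J` (Nekovář naturality + perfectness, Perrin-Riou): `ℓ_{ι𝔭} Λ/⟨Ψ(range toX)⟩ = ℓ_{ι𝔭} Λ/(cs h₀, cf h₀)`.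
THEN, in the tree's keying, `ℓ_{ι𝔭} Y + j(𝔭) = ℓ_𝔭 Y + j(ι𝔭)` (natural keying: `x + j = x′ + j′`). Pure algebra from H1, H2,
`lengthAt_quotient_span_pair_eq_min` (p648952) and the skeleton's `P/range loc ↪ Λ²/Λ·J(loc h₀)`. -/
theorem dualityLedger_of_skeleton
    (loc : H →ₗ[IwasawaAlgebra p] P) (toX : P →ₗ[IwasawaAlgebra p] X) (hexact : Function.Exact loc toX)
    (J : P →ₗ[IwasawaAlgebra p] IwasawaAlgebra p × IwasawaAlgebra p) (hJ : Function.Injective J)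
    (cs cf : H →ₗ[IwasawaAlgebra p] IwasawaAlgebra p) (hcs : ∀ h, cs h = (J (loc h)).1)
    (hcf : ∀ h, cf h = (J (loc h)).2)
    (h₀ : H) (hcyc : ∀ h : H, ∃ r : IwasawaAlgebra p, r • h₀ = h) (hs0 : cs h₀ ≠ 0) (hf0 : cf h₀ ≠ 0)
    (𝔭 : PrimeSpectrum (IwasawaAlgebra p)) (h𝔭 : 𝔭.asIdeal.height = 1)
    (hcoker : Module.lengthAt (IwasawaAlgebra p)
      ((IwasawaAlgebra p × IwasawaAlgebra p) ⧸ LinearMap.range J) 𝔭 = 0)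
    (hcoker' : Module.lengthAt (IwasawaAlgebra p)
      ((IwasawaAlgebra p × IwasawaAlgebra p) ⧸ LinearMap.range J) (PrimeSpectrum.comap (invol p).toRingHom 𝔭) = 0)
    -- (WM) Wingberg/Matar, exact, `γ`-keyed, at both members of the orbit
    (hWM : Module.lengthAt (IwasawaAlgebra p) ↥(Submodule.torsion (IwasawaAlgebra p) X) 𝔭 =
      Module.lengthAt (IwasawaAlgebra p) Y 𝔭)
    -- (KEY) the fine quotient in the same keying
    (hKEY : Module.lengthAt (IwasawaAlgebra p) Y (PrimeSpectrum.comap (invol p).toRingHom 𝔭) =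
      Module.lengthAt (IwasawaAlgebra p) (X ⧸ LinearMap.range toX) 𝔭)
    -- (TF) torsion-free part of Poitou–Tate duality
    (Ψ : X →+ IwasawaAlgebra p) (hΨ : ∀ (r : IwasawaAlgebra p) (x : X), Ψ (r • x) = invol p r * Ψ x)
    (hker : ∀ x : X, Ψ x = 0 ↔ x ∈ Submodule.torsion (IwasawaAlgebra p) X)
    (hcok : Module.lengthAt (IwasawaAlgebra p) (IwasawaAlgebra p ⧸ Ideal.span (Set.range Ψ))
      (PrimeSpectrum.comap (invol p).toRingHom 𝔭) = 0)
    -- (LEG) local leg = local Tate pairing against `loc h₀`, read through the joint Coleman map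
    (hLEG : Module.lengthAt (IwasawaAlgebra p)
        (IwasawaAlgebra p ⧸ Ideal.span (Ψ '' (LinearMap.range toX : Set X)))
        (PrimeSpectrum.comap (invol p).toRingHom 𝔭) =
      Module.lengthAt (IwasawaAlgebra p) (IwasawaAlgebra p ⧸ Ideal.span ({cs h₀, cf h₀} : Set (IwasawaAlgebra p)))
        (PrimeSpectrum.comap (invol p).toRingHom 𝔭)) :
    Module.lengthAt (IwasawaAlgebra p) Y (PrimeSpectrum.comap (invol p).toRingHom 𝔭) +
        min (Module.lengthAt (IwasawaAlgebra p) (IwasawaAlgebra p ⧸ LinearMap.range cs) 𝔭)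
          (Module.lengthAt (IwasawaAlgebra p) (IwasawaAlgebra p ⧸ LinearMap.range cf) 𝔭) =
      Module.lengthAt (IwasawaAlgebra p) Y 𝔭 +
        min (Module.lengthAt (IwasawaAlgebra p) (IwasawaAlgebra p ⧸ LinearMap.range cs)
            (PrimeSpectrum.comap (invol p).toRingHom 𝔭))
          (Module.lengthAt (IwasawaAlgebra p) (IwasawaAlgebra p ⧸ LinearMap.range cf)
            (PrimeSpectrum.comap (invol p).toRingHom 𝔭)) := by
  sorry

end DualityLedger

/-! ## §C  Typed corollary over the child-22569 packages (branch A = the tree's keying) -/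

section Typed

variable (W : WeierstrassCurve ℚ) [W.IsElliptic] [W.IsGloballyMinimal] (p : ℕ) [Fact p.Prime]
  [ContinuousSMul ℤ_[p] (W.tateModule p)] [Module.Free ℤ_[p] (W.tateModule p)]
  [Module.Finite ℤ_[p] (W.tateModule p)]
  {N : ℕ} [NeZero N] {f : CuspForm (Gamma0 N) 2} {ϖ : ℚ} {κ : ZpExtension ℚ p} {γ : absoluteGaloisGroup ℚ}
  {E : Type} [Field E] [Algebra ℚ E] {ι : AlgebraicClosure ℚ →ₐ[ℚ] AlgebraicClosure E}
  {g : absoluteGaloisGroup E} {c : ℕ → localPoints W E} {I : IwasawaH1Data W p κ γ}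

/-- **H4 (typed, PROVED): one member per orbit for the typed stub.** On class X8, given the
DUALITY LEDGER at `𝔭` for the joint package and the `γ`-keyed fine datum `Y` (conclusion of H3 instantiated with
`cs, cf, Y := Cs.colMap, Cf.colMap, Y.X`), the typed stub inequality at the SMALLER-index member `ι𝔭` gives it at `𝔭`
(§A `typedA_of_smallerIndex` + the landed zeta ledger `ClassX8.zeta_add_localIndex_eq_comap_invol`). -/
theorem typedStub_of_smallerIndexMember (hX : ClassX8 W p)
    (Cs : SharpFlatColemanKatoData W p f ϖ κ γ ι (W.frobeniusTrace p) g c Chroma.sharp I)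
    (Cf : SharpFlatColemanKatoData W p f ϖ κ γ ι (W.frobeniusTrace p) g c Chroma.flat I) (hZ : Cs.Z = Cf.Z)
    {Lsharp Lflat Gs Gf : IwasawaAlgebra p} (hf : IsNewformOf W f) (hϖ : (ϖ : ℝ) * W.realPeriodRat = plusPeriod f)
    (hSP : IsSprungPair f p (W.frobeniusTrace p) Lsharp Lflat)
    (hGs : iwasawaToPowerSeries p Gs =
      PowerSeries.C ((ϖ : ℚ) : ℚ_[p]) * iwasawaToPowerSeries p (chromaticL Chroma.sharp Lsharp Lflat))
    (hGf : iwasawaToPowerSeries p Gf =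
      PowerSeries.C ((ϖ : ℚ) : ℚ_[p]) * iwasawaToPowerSeries p (chromaticL Chroma.flat Lsharp Lflat))
    (Y : W.FineSelmerDualData κ γ)
    (𝔭 : PrimeSpectrum (IwasawaAlgebra p)) (h𝔭 : 𝔭.asIdeal.height = 1)
    (hp𝔭 : (p : IwasawaAlgebra p) ∉ 𝔭.asIdeal)
    -- the duality ledger at `𝔭` (H3)
    (hD : Module.lengthAt (IwasawaAlgebra p) Y.X (PrimeSpectrum.comap (invol p).toRingHom 𝔭) +
        min (Module.lengthAt (IwasawaAlgebra p) (IwasawaAlgebra p ⧸ LinearMap.range Cs.colMap) 𝔭)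
          (Module.lengthAt (IwasawaAlgebra p) (IwasawaAlgebra p ⧸ LinearMap.range Cf.colMap) 𝔭) =
      Module.lengthAt (IwasawaAlgebra p) Y.X 𝔭 +
        min (Module.lengthAt (IwasawaAlgebra p) (IwasawaAlgebra p ⧸ LinearMap.range Cs.colMap)
            (PrimeSpectrum.comap (invol p).toRingHom 𝔭))
          (Module.lengthAt (IwasawaAlgebra p) (IwasawaAlgebra p ⧸ LinearMap.range Cf.colMap)
            (PrimeSpectrum.comap (invol p).toRingHom 𝔭)))
    -- `ι𝔭` is the smaller-index member
    (hj : min (Module.lengthAt (IwasawaAlgebra p) (IwasawaAlgebra p ⧸ LinearMap.range Cs.colMap)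
            (PrimeSpectrum.comap (invol p).toRingHom 𝔭))
          (Module.lengthAt (IwasawaAlgebra p) (IwasawaAlgebra p ⧸ LinearMap.range Cf.colMap)
            (PrimeSpectrum.comap (invol p).toRingHom 𝔭)) ≤
      min (Module.lengthAt (IwasawaAlgebra p) (IwasawaAlgebra p ⧸ LinearMap.range Cs.colMap) 𝔭)
          (Module.lengthAt (IwasawaAlgebra p) (IwasawaAlgebra p ⧸ LinearMap.range Cf.colMap) 𝔭))
    -- the local index at `𝔭` is finite (`j ≤ m = ℓ_𝔭 Λ/(Gs) < ⊤`, p648387; displayed)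
    (hjfin : min (Module.lengthAt (IwasawaAlgebra p) (IwasawaAlgebra p ⧸ LinearMap.range Cs.colMap) 𝔭)
          (Module.lengthAt (IwasawaAlgebra p) (IwasawaAlgebra p ⧸ LinearMap.range Cf.colMap) 𝔭) ≠ ⊤)
    -- the typed stub inequality at `ι𝔭`
    (h' : Module.lengthAt (IwasawaAlgebra p) (I.H ⧸ Cs.Z) (PrimeSpectrum.comap (invol p).toRingHom 𝔭) ≤
      Module.lengthAt (IwasawaAlgebra p) Y.X (PrimeSpectrum.comap (invol p).toRingHom 𝔭)) :
    Module.lengthAt (IwasawaAlgebra p) (I.H ⧸ Cs.Z) 𝔭 ≤ Module.lengthAt (IwasawaAlgebra p) Y.X 𝔭 := by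
  have hζ := ClassX8.zeta_add_localIndex_eq_comap_invol W p hX Cs Cf hZ hf hϖ hSP hGs hGf 𝔭 h𝔭 hp𝔭
  have h1 : Module.lengthAt (IwasawaAlgebra p) (I.H ⧸ Cs.Z) 𝔭 +
        min (Module.lengthAt (IwasawaAlgebra p) (IwasawaAlgebra p ⧸ LinearMap.range Cs.colMap) 𝔭)
          (Module.lengthAt (IwasawaAlgebra p) (IwasawaAlgebra p ⧸ LinearMap.range Cf.colMap) 𝔭) ≤
      Module.lengthAt (IwasawaAlgebra p) Y.X 𝔭 +
        min (Module.lengthAt (IwasawaAlgebra p) (IwasawaAlgebra p ⧸ LinearMap.range Cs.colMap) 𝔭)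
          (Module.lengthAt (IwasawaAlgebra p) (IwasawaAlgebra p ⧸ LinearMap.range Cf.colMap) 𝔭) := by
    calc _ = _ := hζ
      _ ≤ _ := add_le_add h' hj
      _ = _ := hD
      _ ≤ _ := add_le_add le_rfl hj
  exact (ENat.add_le_add_iff_right hjfin).mp h1

end Typed

end Summit.BirchSwinnertonDyer.BirchSwinnertonDyer.Cruxes.SprungLowerDivisibilityAtThree.StubKatoFineLowerSporadicK1G3

end
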